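/-
Origin: expansion seat `planner-pub-hodgecm-toy-g2-0`, handover #29 2026-08-18T09:32:03Z (`HOME/pub-hodgecm-toy-g2/lean/ToyG2/TensorRadical.lean`, md5 cf15e0db, 148 lines);
landed by the gen-7 packager in gate run 27 as `HodgeCM/Model/ToyG2/TensorRadical.lean` (verbatim).
-/
/-
# HodgeCM.Model.ToyG2.TensorRadical — the tensor radical lemma (T)

Generation 2 of the `pub-hodgecm-toy` lineage (seat `planner-pub-hodgecm-toy-g2-0`), DESIGN.md §9·UPDATE 09:25Z, lemma (T): the one piece of
abstract linear algebra behind `RadKilled` for PRODUCT targets (generation 3's `RadicalProd`).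

Setting: a field `K`, pairings `B₁ : U₁ × W₁ → K`, `B₂ : U₂ × W₂ → K` with `W₁, W₂` finite-dimensional, and a bilinear form `F : U₁ × U₂ → K`
whose partial evaluations kill the left radicals: `F r · = 0` for `r ∈ ker B₁`, `F · r = 0` for `r ∈ ker B₂`.
* `exists_factor_of_ker_le` : `F a b = B₁ a (E (B₂ b))` for a linear `E : W₂^∨ → W₁` — from `LinearMap.range_dualMap_eq_dualAnnihilator_ker`
  (each `F · b` is representable by `B₁`), a factorisation of `F.flip` through `range B₂` (`Submodule.liftQ` + a linear projection onto
  `range B₂ ⊆ W₂^∨` along a complement, `Submodule.exists_isCompl`) and the projective lifting property of the vector space `W₂^∨`;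
* `exists_sum_mul_of_ker_le` : hence `F a b = Σ_δ B₁ a w_δ · B₂ b e_δ` for finitely many `w_δ ∈ W₁`, `e_δ ∈ W₂`;
* `sum_eq_zero_of_pairings` (T, family form): if `Σ_α B₁(a_α, w₁) B₂(b_α, w₂) = 0` for all `w₁, w₂` then `Σ_α F(a_α, b_α) = 0`;
* `lift_eq_zero_of_pairings` (T, tensor form): if `t ∈ U₁ ⊗ U₂` is killed by every `B₁(·,w₁) ⊗ B₂(·,w₂)` then `lift F t = 0`.
In generation 3 this is applied with `Uₖ = ⋀^{iₖ} H¹Xₖ`, `Bₖ = trPairing Xₖ …`, `F a b = tr_S((f∘ι₁)^*a ∧ (f∘ι₂)^*b)` (DESIGN.md §9).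
-/
import Mathlib

/-! PORT of `HodgeCM/Model/ToyG2/TensorRadical.lean` (HodgeCMPerL run 81) — verbatim mechanical port; provenance in the PORT header line. -/

namespace HodgeCM.ToyG2

open scoped TensorProduct

section TensorRadical

variable {K : Type*} [Field K]
variable {U₁ U₂ W₁ W₂ : Type*} [AddCommGroup U₁] [Module K U₁] [AddCommGroup U₂] [Module K U₂]
  [AddCommGroup W₁] [Module K W₁] [AddCommGroup W₂] [Module K W₂]

/-- the rank-one bilinear form `(a, b) ↦ φ a * ψ b` -/
def mulForm (φ : Module.Dual K U₁) (ψ : Module.Dual K U₂) : U₁ →ₗ[K] U₂ →ₗ[K] K :=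
  (LinearMap.mul K K).compl₁₂ φ ψ

/-- (Ported verbatim from the HodgeCMPerL package; no docstring in the source.) -/
@[simp] theorem mulForm_apply (φ : Module.Dual K U₁) (ψ : Module.Dual K U₂) (a : U₁) (b : U₂) :
    mulForm φ ψ a b = φ a * ψ b := rfl

/-- a functional killing the left radical `ker B` of a pairing `B : U × W → K` (`W` finite-dimensional) is `B(·, w)` for some `w` -/
theorem exists_eq_flip_of_ker_le [FiniteDimensional K W₁] (B₁ : U₁ →ₗ[K] W₁ →ₗ[K] K) (φ : Module.Dual K U₁)
    (h : ∀ r ∈ LinearMap.ker B₁, φ r = 0) : ∃ w : W₁, B₁.flip w = φ := by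
  have hmem : φ ∈ (LinearMap.ker B₁).dualAnnihilator := by
    rw [Submodule.mem_dualAnnihilator]
    exact h
  rw [← LinearMap.range_dualMap_eq_dualAnnihilator_ker, LinearMap.mem_range] at hmem
  obtain ⟨ψ, hψ⟩ := hmem
  refine ⟨(Module.evalEquiv K W₁).symm ψ, ?_⟩
  rw [← hψ]
  ext a
  rw [LinearMap.flip_apply, LinearMap.dualMap_apply]
  exact Module.apply_evalEquiv_symm_apply K W₁ _ ψ

/-- factorisation of a bilinear form whose partial evaluations kill the two left radicals: `F a b = B₁ a (E (B₂ b))` -/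
theorem exists_factor_of_ker_le [FiniteDimensional K W₁] [FiniteDimensional K W₂]
    (B₁ : U₁ →ₗ[K] W₁ →ₗ[K] K) (B₂ : U₂ →ₗ[K] W₂ →ₗ[K] K) (F : U₁ →ₗ[K] U₂ →ₗ[K] K)
    (h₁ : ∀ r ∈ LinearMap.ker B₁, ∀ b, F r b = 0) (h₂ : ∀ r ∈ LinearMap.ker B₂, ∀ a, F a r = 0) :
    ∃ E : Module.Dual K W₂ →ₗ[K] W₁, ∀ a b, F a b = B₁ a (E (B₂ b)) := by
  -- (1) `F.flip` factors through `range B₂`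
  have hker : LinearMap.ker B₂ ≤ LinearMap.ker F.flip := by
    intro r hr
    rw [LinearMap.mem_ker]
    ext a
    exact h₂ r hr a
  let Nbar : LinearMap.range B₂ →ₗ[K] Module.Dual K U₁ :=
    ((LinearMap.ker B₂).liftQ F.flip hker) ∘ₗ B₂.quotKerEquivRange.symm.toLinearMap
  have hNbar : ∀ b, Nbar (B₂.rangeRestrict b) = F.flip b := by
    intro b
    have hq : B₂.quotKerEquivRange.symm (B₂.rangeRestrict b) = (LinearMap.ker B₂).mkQ b := by
      rw [LinearEquiv.symm_apply_eq]
      rfl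
    simp only [Nbar, LinearMap.coe_comp, Function.comp_apply, LinearEquiv.coe_toLinearMap, hq]
    rfl
  -- (2) a retraction of `range B₂ ↪ W₂^∨` extends it to `E₀ : W₂^∨ → U₁^∨`
  obtain ⟨q, hq⟩ := Submodule.exists_isCompl (LinearMap.range B₂)
  let ρ : Module.Dual K W₂ →ₗ[K] LinearMap.range B₂ := Submodule.projectionOnto (LinearMap.range B₂) q hq
  let E₀ : Module.Dual K W₂ →ₗ[K] Module.Dual K U₁ := Nbar ∘ₗ ρ
  have hρ' : ∀ y : LinearMap.range B₂, ρ (y : Module.Dual K W₂) = y := fun y =>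
    Submodule.projectionOnto_apply_left hq y
  have hE₀ : ∀ b, E₀ (B₂ b) = F.flip b := by
    intro b
    have : ρ (B₂ b) = B₂.rangeRestrict b := hρ' (B₂.rangeRestrict b)
    simp only [E₀, LinearMap.coe_comp, Function.comp_apply, this, hNbar]
  -- (3) its values are representable by `B₁`; lift through `B₁.flip` by projectivity of `W₂^∨`
  have hrange : ∀ x, E₀ x ∈ LinearMap.range B₁.flip := by
    intro x
    obtain ⟨u, hu⟩ := (ρ x).2
    have hx : E₀ x = F.flip u := by
      have : ρ x = B₂.rangeRestrict u := Subtype.ext hu.symm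
      simp only [E₀, LinearMap.coe_comp, Function.comp_apply, this, hNbar]
    rw [hx]
    obtain ⟨w, hw⟩ := exists_eq_flip_of_ker_le B₁ (F.flip u) (fun r hr => h₁ r hr u)
    exact ⟨w, hw⟩
  obtain ⟨E, hE⟩ := Module.projective_lifting_property B₁.flip.rangeRestrict (E₀.codRestrict _ hrange)
    (by
      intro y
      obtain ⟨w, hw⟩ := y.2
      exact ⟨w, Subtype.ext hw⟩)
  refine ⟨E, fun a b => ?_⟩
  have h := congrArg Subtype.val (LinearMap.congr_fun hE (B₂ b))
  simp only [LinearMap.coe_comp, Function.comp_apply, LinearMap.codRestrict_apply] at h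
  -- h : B₁.flip (E (B₂ b)) = E₀ (B₂ b)
  have h' := LinearMap.congr_fun (h.trans (hE₀ b)) a
  rw [LinearMap.flip_apply, LinearMap.flip_apply] at h'
  exact h'.symm

/-- rank-one expansion: `F a b = Σ_δ B₁ a w_δ · B₂ b e_δ` -/
theorem exists_sum_mul_of_ker_le [FiniteDimensional K W₁] [FiniteDimensional K W₂]
    (B₁ : U₁ →ₗ[K] W₁ →ₗ[K] K) (B₂ : U₂ →ₗ[K] W₂ →ₗ[K] K) (F : U₁ →ₗ[K] U₂ →ₗ[K] K)
    (h₁ : ∀ r ∈ LinearMap.ker B₁, ∀ b, F r b = 0) (h₂ : ∀ r ∈ LinearMap.ker B₂, ∀ a, F a r = 0) :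
    ∃ (w : Fin (Module.finrank K W₂) → W₁) (e : Fin (Module.finrank K W₂) → W₂),
      ∀ a b, F a b = ∑ δ, B₁ a (w δ) * B₂ b (e δ) := by
  obtain ⟨E, hE⟩ := exists_factor_of_ker_le B₁ B₂ F h₁ h₂
  let bW := Module.finBasis K W₂
  refine ⟨fun δ => E (bW.coord δ), fun δ => bW δ, fun a b => ?_⟩
  calc F a b = B₁ a (E (B₂ b)) := hE a b
    _ = B₁ a (E (∑ δ, B₂ b (bW δ) • bW.coord δ)) := by rw [bW.sum_dual_apply_smul_coord]
    _ = ∑ δ, B₁ a (E (bW.coord δ)) * B₂ b (bW δ) := by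
        rw [map_sum, map_sum]
        exact Finset.sum_congr rfl fun δ _ => by rw [map_smul, map_smul, smul_eq_mul, mul_comm]

/-- **(T), family form**: a finite family `(a_α, b_α)` killed by all `B₁(·, w₁) ⊗ B₂(·, w₂)` is killed by `F` -/
theorem sum_eq_zero_of_pairings [FiniteDimensional K W₁] [FiniteDimensional K W₂]
    (B₁ : U₁ →ₗ[K] W₁ →ₗ[K] K) (B₂ : U₂ →ₗ[K] W₂ →ₗ[K] K) (F : U₁ →ₗ[K] U₂ →ₗ[K] K)
    (h₁ : ∀ r ∈ LinearMap.ker B₁, ∀ b, F r b = 0) (h₂ : ∀ r ∈ LinearMap.ker B₂, ∀ a, F a r = 0)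
    {ι : Type*} (s : Finset ι) (a : ι → U₁) (b : ι → U₂)
    (ht : ∀ w₁ w₂, ∑ α ∈ s, B₁ (a α) w₁ * B₂ (b α) w₂ = 0) : ∑ α ∈ s, F (a α) (b α) = 0 := by
  obtain ⟨w, e, hF⟩ := exists_sum_mul_of_ker_le B₁ B₂ F h₁ h₂
  simp_rw [hF]
  rw [Finset.sum_comm]
  exact Finset.sum_eq_zero fun δ _ => ht (w δ) (e δ)

/-- **(T), tensor form**: an element of `U₁ ⊗ U₂` killed by all `B₁(·, w₁) ⊗ B₂(·, w₂)` is killed by `lift F` -/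
theorem lift_eq_zero_of_pairings [FiniteDimensional K W₁] [FiniteDimensional K W₂]
    (B₁ : U₁ →ₗ[K] W₁ →ₗ[K] K) (B₂ : U₂ →ₗ[K] W₂ →ₗ[K] K) (F : U₁ →ₗ[K] U₂ →ₗ[K] K)
    (h₁ : ∀ r ∈ LinearMap.ker B₁, ∀ b, F r b = 0) (h₂ : ∀ r ∈ LinearMap.ker B₂, ∀ a, F a r = 0)
    (t : U₁ ⊗[K] U₂) (ht : ∀ w₁ w₂, TensorProduct.lift (mulForm (B₁.flip w₁) (B₂.flip w₂)) t = 0) :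
    TensorProduct.lift F t = 0 := by
  obtain ⟨w, e, hF⟩ := exists_sum_mul_of_ker_le B₁ B₂ F h₁ h₂
  have key : ∀ t : U₁ ⊗[K] U₂,
      TensorProduct.lift F t = ∑ δ, TensorProduct.lift (mulForm (B₁.flip (w δ)) (B₂.flip (e δ))) t := by
    intro t
    induction t using TensorProduct.induction_on with
    | zero => simp
    | tmul a b => simp only [TensorProduct.lift.tmul, mulForm_apply, LinearMap.flip_apply, hF]
    | add x y hx hy => rw [map_add, hx, hy, ← Finset.sum_add_distrib]; simp only [map_add]
  rw [key]
  exact Finset.sum_eq_zero fun δ _ => ht (w δ) (e δ)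

end TensorRadical

end HodgeCM.ToyG2
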